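import Summits.AnomalousDissipation.AnomalousDissipation.Theorems.SawtoothPulseCascadeK1LocalisedCascadeKHForcingModes

/-!
# K2 lane: p4's `forcing` of a finite mode profile IN CLOSED FORM, by name

prover ad-k1loc-p2 g10 (K2 lane), crux workfile on the dir of stmt-AnomalousDissipation-19491. Consumes the tree theorems
`…K2PhaseBudget.forcing_src_quarter` / `forcing_src_negQuarter` (p689452), `integral_forcing_finset_sum` (p690239) for the typed one-family objects of
`K2ConeSketch.lean` §0/§2 (planner p4; `lineKernel` with p2's sign fix, `transportPhase`, `LamState`, `win`, `modeProfile`, `forcing`) — repeated below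
CHARACTER-FOR-CHARACTER (the Cruxes modules are not importable on the farm), namespace `…K2ForcingClosedForm`. PROVED for `a > 0`:
* `lineKernel_eq`: p4's kernel is the quasi-periodic extension `e^{2πiβ⌊u⌋} K(u − ⌊u⌋)` of the tree's closed form `K` (`kernelK`, `|a| = a`);
* `forcing_modeProfile_apply`: both components of `forcing a β ⟨modeProfile β K c, []⟩ s` are `2πia·(∓2)·Σ_{n ∈ win K} c n · src(±¼, β+n, s)`;
* `src_quarter_eq` / `src_negQuarter_eq`: each single-mode source `src(±¼, ξ, s)` equals the explicit six-term sum `srcQuarter a β ξ s` / `srcNegQuarter a β ξ s`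
  (trough `e^{+iπas}`, centre, crest `e^{−iπas}` pieces; Lorentzian denominators `±2πa + 2πi(ξ ± as)`);
* `forcing_modeProfile_closedForm`: the two together.
With `…KHLorentzEnvelope` / `…KHStablePulseResponse` / `…KHStableDetuning` / `…KHStableRotation` (per-term detuned response, `ω ∈ [0.55a, πa/2 − 399/401]` for `a ≥ 1`)
this is the input of the single-mode stable-block creation bound (P1″); nothing here is K2.
-/

open Set MeasureTheory intervalIntegral

set_option linter.dupNamespace false

namespace Summit.AnomalousDissipation.AnomalousDissipation.Cruxes.K1LocalisedCascade.K2ForcingClosedForm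

open Literature.Analysis.FluidPDE.SawtoothCascade
open Summit.AnomalousDissipation.AnomalousDissipation.Theorems.SawtoothPulseCascade.K2PhaseBudget

noncomputable section

/-! ## Verbatim copies (p4: `K2ConeSketch.lean` §0.1–0.2, §1 `win`, §2 `modeProfile`) -/

/-- The periodised Biot–Savart LINE KERNEL of the family with streamwise wavenumber `a` and transverse Bloch
phase `β`: `G_{a,β}(y) = Σ_{n∈ℤ} e^{2πiβn} g(y - n)`, `g(y) = -e^{-κ|y|}/(2κ)`, `κ = 2π|a|`, in closed form on
`y = ⌊y⌋ + r`: `e^{2πiβ⌊y⌋} · (-(e^{-κr}/(1 - e^{-2πiβ}e^{-κ}) + e^{κ(r-1)} e^{2πiβ}/(1 - e^{2πiβ}e^{-κ}))/(2κ))` (p2's corrected sign). -/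
def lineKernel (a β y : ℝ) : ℂ :=
  let κ : ℝ := 2 * Real.pi * |a|
  let r : ℝ := y - (⌊y⌋ : ℝ)
  let z : ℂ := Complex.exp (2 * Real.pi * β * Complex.I)
  Complex.exp (2 * Real.pi * β * (⌊y⌋ : ℝ) * Complex.I) *
    ((-(((Real.exp (-(κ * r)) : ℂ) / (1 - (starRingEnd ℂ z) * (Real.exp (-κ) : ℂ)))
          + (Real.exp (κ * (r - 1)) : ℂ) * z / (1 - z * (Real.exp (-κ) : ℂ)))) / (2 * κ : ℂ))

/-- Transport multiplier of an H slot of total strain `θ` on the streamwise mode `a`: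
`e^{2πiax} ζ₀(y) ↦ e^{2πia(x - θ·triWave y)} ζ₀(y)`. -/
def transportPhase (a θ y : ℝ) : ℂ :=
  Complex.exp (-(2 * Real.pi * a * θ * triWave y : ℝ) * Complex.I)

/-- S-4 state of ONE line family: an interior density profile on the period `[-1/2, 1/2)` plus finitely many vortex SHEETS
`(position yᵢ, amplitude cᵢ)`. -/
structure LamState where
  interior : ℝ → ℂ
  sheets : List (ℝ × ℂ)

/-- Forcing of the block at slot-time `s`: `f(s) = 2πia · (-2 ∫ G(1/4 - y) dμ_s(y), 2 ∫ G(-1/4 - y) dμ_s(y))`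
where `μ_s = transported state = (ζ₀(y) dy + Σ cᵢ δ_{yᵢ}) · e^{-2πias·triWave y}`. -/
def forcing (a β : ℝ) (st : LamState) (s : ℝ) : Fin 2 → ℂ :=
  let src : ℝ → ℂ := fun y0 =>
    (∫ y in (-(1 / 2 : ℝ))..(1 / 2), lineKernel a β (y0 - y) * st.interior y * transportPhase a s y)
      + (st.sheets.map (fun p => lineKernel a β (y0 - p.1) * p.2 * transportPhase a s p.1)).sum
  ![((2 * Real.pi * a : ℝ) * Complex.I : ℂ) * (-2) * src (1 / 4),
    ((2 * Real.pi * a : ℝ) * Complex.I : ℂ) * 2 * src (-(1 / 4))]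

/-- The truncation window `[-K, K]`. -/
def win (K : ℕ) : Finset ℤ := Finset.Icc (-(K : ℤ)) K

/-- The transverse profile `y ↦ Σ_{|n| ≤ K} c(n) e^{2πi(β+n)y}` of a truncated coefficient row. -/
def modeProfile (β : ℝ) (K : ℕ) (c : ℤ → ℂ) : ℝ → ℂ :=
  fun y => ∑ n ∈ win K, c n * Complex.exp ((2 * Real.pi * (β + n) * y : ℝ) * Complex.I)

/-! ## The kernel as the quasi-periodic extension of the tree's closed form -/

/-- The tree's closed form of the kernel on one period (`…KHLineKernelSum.lineKernel_hasSum`, `…KHLineKernelFourier`), as a function of `r`. -/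
def kernelK (a β : ℝ) : ℝ → ℂ := fun r : ℝ => (-((Real.exp (-(2 * Real.pi * a * r)) : ℂ) /
            (1 - starRingEnd ℂ (Complex.exp (2 * Real.pi * β * Complex.I)) * (Real.exp (-(2 * Real.pi * a)) : ℂ))
          + (Real.exp (2 * Real.pi * a * (r - 1)) : ℂ) * Complex.exp (2 * Real.pi * β * Complex.I) /
            (1 - Complex.exp (2 * Real.pi * β * Complex.I) * (Real.exp (-(2 * Real.pi * a)) : ℂ))) /
        (2 * (2 * Real.pi * a) : ℂ))

/-- For `a > 0`, p4's `lineKernel a β u = e^{2πiβ⌊u⌋} · kernelK a β (u − ⌊u⌋)` (`|a| = a`). -/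
theorem lineKernel_eq {a : ℝ} (ha : 0 < a) (β : ℝ) (u : ℝ) :
    lineKernel a β u = Complex.exp (2 * Real.pi * β * (⌊u⌋ : ℝ) * Complex.I) * kernelK a β (u - ⌊u⌋) := by
  simp only [lineKernel, kernelK, abs_of_pos ha]
  push_cast
  ring_nf

/-! ## The forcing of a mode profile: linearity, then the closed form -/

/-- The single-mode source in closed form at `y₀ = ¼` (the right-hand side of the tree's `forcing_src_quarter`). -/
def srcQuarter (a β ξ s : ℝ) : ℂ :=
      Complex.exp (((Real.pi * a * s : ℝ) : ℂ) * Complex.I) *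
        (((1 : ℂ) * (-1 / ((1 - starRingEnd ℂ (Complex.exp (2 * Real.pi * β * Complex.I)) * (Real.exp (-(2 * Real.pi * a)) : ℂ)) * (2 * (2 * Real.pi * a)))) * Complex.exp (-((2 * Real.pi * a : ℝ) : ℂ) * (1 / 4 : ℝ))) *
            ((Complex.exp ((((2 * Real.pi * a : ℝ) : ℂ) + (((2 * Real.pi * (ξ + a * s) : ℝ)) : ℂ) * Complex.I) * (-(1 / 4 : ℝ))) - Complex.exp ((((2 * Real.pi * a : ℝ) : ℂ) + (((2 * Real.pi * (ξ + a * s) : ℝ)) : ℂ) * Complex.I) * (-(1 / 2 : ℝ)))) / (((2 * Real.pi * a : ℝ) : ℂ) + (((2 * Real.pi * (ξ + a * s) : ℝ)) : ℂ) * Complex.I)) +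
          ((1 : ℂ) * (-(Complex.exp (2 * Real.pi * β * Complex.I) * (Real.exp (-(2 * Real.pi * a)) : ℂ)) / ((1 - Complex.exp (2 * Real.pi * β * Complex.I) * (Real.exp (-(2 * Real.pi * a)) : ℂ)) * (2 * (2 * Real.pi * a)))) * Complex.exp (((2 * Real.pi * a : ℝ) : ℂ) * (1 / 4 : ℝ))) *
            ((Complex.exp ((-((2 * Real.pi * a : ℝ) : ℂ) + (((2 * Real.pi * (ξ + a * s) : ℝ)) : ℂ) * Complex.I) * (-(1 / 4 : ℝ))) - Complex.exp ((-((2 * Real.pi * a : ℝ) : ℂ) + (((2 * Real.pi * (ξ + a * s) : ℝ)) : ℂ) * Complex.I) * (-(1 / 2 : ℝ)))) / (-((2 * Real.pi * a : ℝ) : ℂ) + (((2 * Real.pi * (ξ + a * s) : ℝ)) : ℂ) * Complex.I))) +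
      (1 : ℂ) *
        (((1 : ℂ) * (-1 / ((1 - starRingEnd ℂ (Complex.exp (2 * Real.pi * β * Complex.I)) * (Real.exp (-(2 * Real.pi * a)) : ℂ)) * (2 * (2 * Real.pi * a)))) * Complex.exp (-((2 * Real.pi * a : ℝ) : ℂ) * (1 / 4 : ℝ))) *
            ((Complex.exp ((((2 * Real.pi * a : ℝ) : ℂ) + (((2 * Real.pi * (ξ - a * s) : ℝ)) : ℂ) * Complex.I) * (1 / 4 : ℝ)) - Complex.exp ((((2 * Real.pi * a : ℝ) : ℂ) + (((2 * Real.pi * (ξ - a * s) : ℝ)) : ℂ) * Complex.I) * (-(1 / 4 : ℝ)))) / (((2 * Real.pi * a : ℝ) : ℂ) + (((2 * Real.pi * (ξ - a * s) : ℝ)) : ℂ) * Complex.I)) +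
          ((1 : ℂ) * (-(Complex.exp (2 * Real.pi * β * Complex.I) * (Real.exp (-(2 * Real.pi * a)) : ℂ)) / ((1 - Complex.exp (2 * Real.pi * β * Complex.I) * (Real.exp (-(2 * Real.pi * a)) : ℂ)) * (2 * (2 * Real.pi * a)))) * Complex.exp (((2 * Real.pi * a : ℝ) : ℂ) * (1 / 4 : ℝ))) *
            ((Complex.exp ((-((2 * Real.pi * a : ℝ) : ℂ) + (((2 * Real.pi * (ξ - a * s) : ℝ)) : ℂ) * Complex.I) * (1 / 4 : ℝ)) - Complex.exp ((-((2 * Real.pi * a : ℝ) : ℂ) + (((2 * Real.pi * (ξ - a * s) : ℝ)) : ℂ) * Complex.I) * (-(1 / 4 : ℝ)))) / (-((2 * Real.pi * a : ℝ) : ℂ) + (((2 * Real.pi * (ξ - a * s) : ℝ)) : ℂ) * Complex.I))) +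
      Complex.exp (-((Real.pi * a * s : ℝ) : ℂ) * Complex.I) *
        (((starRingEnd ℂ (Complex.exp (2 * Real.pi * β * Complex.I))) * (-1 / ((1 - starRingEnd ℂ (Complex.exp (2 * Real.pi * β * Complex.I)) * (Real.exp (-(2 * Real.pi * a)) : ℂ)) * (2 * (2 * Real.pi * a)))) * Complex.exp (-((2 * Real.pi * a : ℝ) : ℂ) * (5 / 4 : ℝ))) *
            ((Complex.exp ((((2 * Real.pi * a : ℝ) : ℂ) + (((2 * Real.pi * (ξ + a * s) : ℝ)) : ℂ) * Complex.I) * (1 / 2 : ℝ)) - Complex.exp ((((2 * Real.pi * a : ℝ) : ℂ) + (((2 * Real.pi * (ξ + a * s) : ℝ)) : ℂ) * Complex.I) * (1 / 4 : ℝ))) / (((2 * Real.pi * a : ℝ) : ℂ) + (((2 * Real.pi * (ξ + a * s) : ℝ)) : ℂ) * Complex.I)) +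
          ((starRingEnd ℂ (Complex.exp (2 * Real.pi * β * Complex.I))) * (-(Complex.exp (2 * Real.pi * β * Complex.I) * (Real.exp (-(2 * Real.pi * a)) : ℂ)) / ((1 - Complex.exp (2 * Real.pi * β * Complex.I) * (Real.exp (-(2 * Real.pi * a)) : ℂ)) * (2 * (2 * Real.pi * a)))) * Complex.exp (((2 * Real.pi * a : ℝ) : ℂ) * (5 / 4 : ℝ))) *
            ((Complex.exp ((-((2 * Real.pi * a : ℝ) : ℂ) + (((2 * Real.pi * (ξ + a * s) : ℝ)) : ℂ) * Complex.I) * (1 / 2 : ℝ)) - Complex.exp ((-((2 * Real.pi * a : ℝ) : ℂ) + (((2 * Real.pi * (ξ + a * s) : ℝ)) : ℂ) * Complex.I) * (1 / 4 : ℝ))) / (-((2 * Real.pi * a : ℝ) : ℂ) + (((2 * Real.pi * (ξ + a * s) : ℝ)) : ℂ) * Complex.I)))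

/-- The single-mode source in closed form at `y₀ = −¼` (the right-hand side of the tree's `forcing_src_negQuarter`). -/
def srcNegQuarter (a β ξ s : ℝ) : ℂ :=
      Complex.exp (((Real.pi * a * s : ℝ) : ℂ) * Complex.I) *
        (((1 : ℂ) * (-1 / ((1 - starRingEnd ℂ (Complex.exp (2 * Real.pi * β * Complex.I)) * (Real.exp (-(2 * Real.pi * a)) : ℂ)) * (2 * (2 * Real.pi * a)))) * Complex.exp (-((2 * Real.pi * a : ℝ) : ℂ) * (-(1 / 4 : ℝ)))) *
            ((Complex.exp ((((2 * Real.pi * a : ℝ) : ℂ) + (((2 * Real.pi * (ξ + a * s) : ℝ)) : ℂ) * Complex.I) * (-(1 / 4 : ℝ))) - Complex.exp ((((2 * Real.pi * a : ℝ) : ℂ) + (((2 * Real.pi * (ξ + a * s) : ℝ)) : ℂ) * Complex.I) * (-(1 / 2 : ℝ)))) / (((2 * Real.pi * a : ℝ) : ℂ) + (((2 * Real.pi * (ξ + a * s) : ℝ)) : ℂ) * Complex.I)) +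
          ((1 : ℂ) * (-(Complex.exp (2 * Real.pi * β * Complex.I) * (Real.exp (-(2 * Real.pi * a)) : ℂ)) / ((1 - Complex.exp (2 * Real.pi * β * Complex.I) * (Real.exp (-(2 * Real.pi * a)) : ℂ)) * (2 * (2 * Real.pi * a)))) * Complex.exp (((2 * Real.pi * a : ℝ) : ℂ) * (-(1 / 4 : ℝ)))) *
            ((Complex.exp ((-((2 * Real.pi * a : ℝ) : ℂ) + (((2 * Real.pi * (ξ + a * s) : ℝ)) : ℂ) * Complex.I) * (-(1 / 4 : ℝ))) - Complex.exp ((-((2 * Real.pi * a : ℝ) : ℂ) + (((2 * Real.pi * (ξ + a * s) : ℝ)) : ℂ) * Complex.I) * (-(1 / 2 : ℝ)))) / (-((2 * Real.pi * a : ℝ) : ℂ) + (((2 * Real.pi * (ξ + a * s) : ℝ)) : ℂ) * Complex.I))) +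
      (1 : ℂ) *
        (((starRingEnd ℂ (Complex.exp (2 * Real.pi * β * Complex.I))) * (-1 / ((1 - starRingEnd ℂ (Complex.exp (2 * Real.pi * β * Complex.I)) * (Real.exp (-(2 * Real.pi * a)) : ℂ)) * (2 * (2 * Real.pi * a)))) * Complex.exp (-((2 * Real.pi * a : ℝ) : ℂ) * (3 / 4 : ℝ))) *
            ((Complex.exp ((((2 * Real.pi * a : ℝ) : ℂ) + (((2 * Real.pi * (ξ - a * s) : ℝ)) : ℂ) * Complex.I) * (1 / 4 : ℝ)) - Complex.exp ((((2 * Real.pi * a : ℝ) : ℂ) + (((2 * Real.pi * (ξ - a * s) : ℝ)) : ℂ) * Complex.I) * (-(1 / 4 : ℝ)))) / (((2 * Real.pi * a : ℝ) : ℂ) + (((2 * Real.pi * (ξ - a * s) : ℝ)) : ℂ) * Complex.I)) +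
          ((starRingEnd ℂ (Complex.exp (2 * Real.pi * β * Complex.I))) * (-(Complex.exp (2 * Real.pi * β * Complex.I) * (Real.exp (-(2 * Real.pi * a)) : ℂ)) / ((1 - Complex.exp (2 * Real.pi * β * Complex.I) * (Real.exp (-(2 * Real.pi * a)) : ℂ)) * (2 * (2 * Real.pi * a)))) * Complex.exp (((2 * Real.pi * a : ℝ) : ℂ) * (3 / 4 : ℝ))) *
            ((Complex.exp ((-((2 * Real.pi * a : ℝ) : ℂ) + (((2 * Real.pi * (ξ - a * s) : ℝ)) : ℂ) * Complex.I) * (1 / 4 : ℝ)) - Complex.exp ((-((2 * Real.pi * a : ℝ) : ℂ) + (((2 * Real.pi * (ξ - a * s) : ℝ)) : ℂ) * Complex.I) * (-(1 / 4 : ℝ)))) / (-((2 * Real.pi * a : ℝ) : ℂ) + (((2 * Real.pi * (ξ - a * s) : ℝ)) : ℂ) * Complex.I))) +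
      Complex.exp (-((Real.pi * a * s : ℝ) : ℂ) * Complex.I) *
        (((starRingEnd ℂ (Complex.exp (2 * Real.pi * β * Complex.I))) * (-1 / ((1 - starRingEnd ℂ (Complex.exp (2 * Real.pi * β * Complex.I)) * (Real.exp (-(2 * Real.pi * a)) : ℂ)) * (2 * (2 * Real.pi * a)))) * Complex.exp (-((2 * Real.pi * a : ℝ) : ℂ) * (3 / 4 : ℝ))) *
            ((Complex.exp ((((2 * Real.pi * a : ℝ) : ℂ) + (((2 * Real.pi * (ξ + a * s) : ℝ)) : ℂ) * Complex.I) * (1 / 2 : ℝ)) - Complex.exp ((((2 * Real.pi * a : ℝ) : ℂ) + (((2 * Real.pi * (ξ + a * s) : ℝ)) : ℂ) * Complex.I) * (1 / 4 : ℝ))) / (((2 * Real.pi * a : ℝ) : ℂ) + (((2 * Real.pi * (ξ + a * s) : ℝ)) : ℂ) * Complex.I)) +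
          ((starRingEnd ℂ (Complex.exp (2 * Real.pi * β * Complex.I))) * (-(Complex.exp (2 * Real.pi * β * Complex.I) * (Real.exp (-(2 * Real.pi * a)) : ℂ)) / ((1 - Complex.exp (2 * Real.pi * β * Complex.I) * (Real.exp (-(2 * Real.pi * a)) : ℂ)) * (2 * (2 * Real.pi * a)))) * Complex.exp (((2 * Real.pi * a : ℝ) : ℂ) * (3 / 4 : ℝ))) *
            ((Complex.exp ((-((2 * Real.pi * a : ℝ) : ℂ) + (((2 * Real.pi * (ξ + a * s) : ℝ)) : ℂ) * Complex.I) * (1 / 2 : ℝ)) - Complex.exp ((-((2 * Real.pi * a : ℝ) : ℂ) + (((2 * Real.pi * (ξ + a * s) : ℝ)) : ℂ) * Complex.I) * (1 / 4 : ℝ))) / (-((2 * Real.pi * a : ℝ) : ℂ) + (((2 * Real.pi * (ξ + a * s) : ℝ)) : ℂ) * Complex.I)))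

/-- The single-mode source integral at `y₀ = ¼` IS `srcQuarter` (`a > 0`). -/
theorem src_quarter_eq {a : ℝ} (ha : 0 < a) (β ξ s : ℝ) :
    ∫ y in (-(1 / 2 : ℝ))..(1 / 2 : ℝ), lineKernel a β ((1 / 4 : ℝ) - y) * Complex.exp (((2 * Real.pi * ξ * y : ℝ) : ℂ) * Complex.I) *
        Complex.exp (-((2 * Real.pi * a * s * triWave y : ℝ) : ℂ) * Complex.I) = srcQuarter a β ξ s :=
  forcing_src_quarter ha β ξ s (K := kernelK a β) rfl (lineKernel_eq ha β)

/-- The single-mode source integral at `y₀ = −¼` IS `srcNegQuarter` (`a > 0`). -/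
theorem src_negQuarter_eq {a : ℝ} (ha : 0 < a) (β ξ s : ℝ) :
    ∫ y in (-(1 / 2 : ℝ))..(1 / 2 : ℝ), lineKernel a β ((-(1 / 4 : ℝ)) - y) * Complex.exp (((2 * Real.pi * ξ * y : ℝ) : ℂ) * Complex.I) *
        Complex.exp (-((2 * Real.pi * a * s * triWave y : ℝ) : ℂ) * Complex.I) = srcNegQuarter a β ξ s :=
  forcing_src_negQuarter ha β ξ s (K := kernelK a β) rfl (lineKernel_eq ha β)

/-- **Linearity:** the forcing of the mode profile `Σ_{n ∈ win K} c n e^{2πi(β+n)y}` (no sheets) is `2πia·(∓2)·Σ_n c n · (single-mode source)`. -/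
theorem forcing_modeProfile_apply {a : ℝ} (ha : 0 < a) (β s : ℝ) (K : ℕ) (c : ℤ → ℂ) :
    forcing a β ⟨modeProfile β K c, []⟩ s 0 = ((2 * Real.pi * a : ℝ) * Complex.I : ℂ) * (-2) *
        ∑ n ∈ win K, c n * ∫ y in (-(1 / 2 : ℝ))..(1 / 2 : ℝ), lineKernel a β (1 / 4 - y) *
          Complex.exp (((2 * Real.pi * (β + n) * y : ℝ) : ℂ) * Complex.I) * Complex.exp (-((2 * Real.pi * a * s * triWave y : ℝ) : ℂ) * Complex.I) ∧
    forcing a β ⟨modeProfile β K c, []⟩ s 1 = ((2 * Real.pi * a : ℝ) * Complex.I : ℂ) * 2 *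
        ∑ n ∈ win K, c n * ∫ y in (-(1 / 2 : ℝ))..(1 / 2 : ℝ), lineKernel a β (-(1 / 4) - y) *
          Complex.exp (((2 * Real.pi * (β + n) * y : ℝ) : ℂ) * Complex.I) * Complex.exp (-((2 * Real.pi * a * s * triWave y : ℝ) : ℂ) * Complex.I) := by
  have h1 := integral_forcing_finset_sum ha β s (K := kernelK a β) rfl (lineKernel_eq ha β) (y₀ := 1 / 4) (Or.inl rfl) (win K) c
  have h2 := integral_forcing_finset_sum ha β s (K := kernelK a β) rfl (lineKernel_eq ha β) (y₀ := -(1 / 4)) (Or.inr rfl) (win K) c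
  simp only [forcing, modeProfile, transportPhase, List.map_nil, List.sum_nil, add_zero, Matrix.cons_val_zero, Matrix.cons_val_one]
  exact ⟨by rw [h1], by rw [h2]⟩

/-- **p4's forcing of a finite mode profile in closed form** (`a > 0`): component `0` (kink line `y = ¼`) is
`2πia·(−2)·Σ_{n ∈ win K} c n · srcQuarter a β (β+n) s`, component `1` (line `y = −¼`) is `2πia·2·Σ_n c n · srcNegQuarter a β (β+n) s`. -/
theorem forcing_modeProfile_closedForm {a : ℝ} (ha : 0 < a) (β s : ℝ) (K : ℕ) (c : ℤ → ℂ) :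
    forcing a β ⟨modeProfile β K c, []⟩ s 0 = ((2 * Real.pi * a : ℝ) * Complex.I : ℂ) * (-2) * ∑ n ∈ win K, c n * srcQuarter a β (β + n) s ∧
    forcing a β ⟨modeProfile β K c, []⟩ s 1 = ((2 * Real.pi * a : ℝ) * Complex.I : ℂ) * 2 * ∑ n ∈ win K, c n * srcNegQuarter a β (β + n) s := by
  obtain ⟨h0, h1⟩ := forcing_modeProfile_apply ha β s K c
  refine ⟨?_, ?_⟩
  · rw [h0]; congr 1; exact Finset.sum_congr rfl fun n _ => by rw [src_quarter_eq ha]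
  · rw [h1]; congr 1; exact Finset.sum_congr rfl fun n _ => by rw [src_negQuarter_eq ha]

end

end Summit.AnomalousDissipation.AnomalousDissipation.Cruxes.K1LocalisedCascade.K2ForcingClosedForm
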